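import Mathlib.Analysis.SpecialFunctions.ExpDeriv
import Mathlib.Analysis.Calculus.FDeriv.Pow
import Mathlib.Analysis.Complex.Trigonometric
import Summits.QuantumFields.YangMills.Theorems.BalabanUVNodesN22W1RelCentredSector

/-!
# BalabanUVNodes ∕ node N22 = NE9 — THE W1 OBJECT ON THE RELATIVE-DISC CENTRED ROAD (RE-TYPING M1′), MODULE R6: A POSSIBILITY-1 MODEL TERM INHABITS THE RE-TYPED LAST-COUPLING
# CLAUSES ON THE SECTOR — the threshold shape `z ↦ V + A·z² + B·exp(−a∕z²)` is holomorphic on the sector of aperture `c < ½` and obeys the CENTRED ORDER-TWO letter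
# `‖f z − V‖ ≤ Mv·‖z‖²` there (explicit `Mv`), although it is flat and non-analytic at zero coupling (the class that located the uniform-disc road, F3)

Cell `pub-ymgap`, HUMAN RULING D-0062 (Track A), R134 ACCELERATION re-seat `pub-ymgap-dag-n22-c` (strategy s1), generation 6, file R6 of the re-typed line.  THEOREMS ONLY; Mathlib +
R3 `…N22W1RelCentredSector` (`zero_not_mem_relSector`).  `--supports` K3⁗ `SpineGivenEndpointR13Sep` (stmt-QuantumFields-20292) as a helper.

WHY.  F3 (`…N22W1StripLastTermwiseVertexRider`) certified that the OLD last-coupling clause (uniform discs `closedBall (t:ℂ) r`, `t ∈ ]0,γ]`) forces analyticity at zero coupling and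
is therefore uninhabitable by the possibility-1 term of record ([I] (2.9)–(2.10): thresholds `exp(−O(1)∕g²)`, flat at `g = 0`).  The re-typed leaf (R2 ∕ R2b ∕ R2c) asks instead,
on a domain family containing the RELATIVE discs `closedBall (t:ℂ)(cA·t)`, holomorphy of the continued term in its last coupling and the centred order-two letter (S-vertex-T′)
`‖TFc … z … − V …‖ ≤ Mv·‖z‖²·(weight)`.  THIS FILE runs the survival test the located road failed: the MODEL possibility-1 term `f z := V + A·z² + B·exp(−a·(z²)⁻¹)` (`a > 0`:
an even analytic part plus a threshold flat at `0`) IS holomorphic on the sector `S_c := {z | ∃ t ∈ ]0,γ], dist z t < c·t}` (it avoids `0`, R3) and, for aperture `c < ½` — where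
`Re z² > (1−2c)·t² > 0`, i.e. inside print's temperature half-plane `Re (1∕z²) > 0` of the pre-scaling display (2.10) p.267 (lens T14 ∕ T19: `cos (2·arg z) > 0`) — satisfies
`‖f z − V‖ ≤ (‖A‖ + ‖B‖·(1+c)⁴ ∕ (a·(1−2c)·(1−c)²))·‖z‖²` on `S_c`: the threshold is priced by `exp(−x) ≤ 1∕x` at `x = a·Re (1∕z²) ≥ a(1−2c)∕((1+c)⁴ t²)` and `t < ‖z‖∕(1−c)`.
So the re-typed clauses are inhabited by exactly the term shape that killed the uniform-disc clauses — evidence that M1′ re-types the location rather than moving it.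

WHAT.  §1 sector geometry at aperture `c < ½`: `re_gt_of_near`, `abs_im_lt_of_near`, `re_sq_gt_of_near` (`(1−2c)t² < Re z²`), `norm_lt_of_near` (`‖z‖ < (1+c)t`), `lt_norm_of_near` (`(1−c)t < ‖z‖`), `inv_sq_re_ge_of_near`
(`a(1−2c)∕((1+c)⁴t²) ≤ a·Re (z²)⁻¹`); §2 the threshold price `norm_exp_neg_inv_sq_le` (`‖exp(−a(z²)⁻¹)‖ ≤ (1+c)⁴ t² ∕ (a(1−2c))`); §3 ★ `modelTerm_sub_centre_le_on_relSector`
(the (S-vertex-T′)-shape bound with the explicit `Mv`) and ★ `differentiableOn_modelTerm_relSector` (holomorphy on the sector, any `c ≤ 1`).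

HONEST FRAMING.  A MODEL computation (elementary complex analysis), count-neutral: it shows the re-typed clauses are inhabitable by threshold-type terms, NOT that Bałaban's (2.14)
term satisfies them (that is the unowned producer P″ — CONSUMER-SHAPE-R2c.md); nothing of Bałaban's asserted; N22 NOT discharged.  0 `sorry`, 0 `def`, standard axioms.

References (TYPES only): [I] = [Balaban1987RG1] §1 p. 263 (window `]0,γ]`), (2.9)–(2.10) pp. 266–267 (possibility 1, pre-scaling display), (2.13) p. 268.
-/

noncomputable section

namespace YMDAG.N22.W1

open Set Metric Complex

/-! ## §1 Sector geometry at aperture `c < ½` -/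

/-- `dist z t < c·t`: `(1 − c)·t < Re z`. [folklore] -/
theorem re_gt_of_near {c t : ℝ} {z : ℂ} (hz : dist z (t : ℂ) < c * t) : (1 - c) * t < z.re := by
  have h := abs_re_le_norm (z - (t : ℂ))
  rw [sub_re, ofReal_re] at h
  rw [dist_eq_norm] at hz
  have h3 := (abs_lt.mp (lt_of_le_of_lt h hz)).1
  linarith

/-- `dist z t < c·t`: `|Im z| < c·t`. [folklore] -/
theorem abs_im_lt_of_near {c t : ℝ} {z : ℂ} (hz : dist z (t : ℂ) < c * t) : |z.im| < c * t := by
  have h := abs_im_le_norm (z - (t : ℂ))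
  rw [sub_im, ofReal_im, sub_zero] at h
  rw [dist_eq_norm] at hz
  exact lt_of_le_of_lt h hz

/-- `dist z t < c·t`, `0 < t`, `c < ½`: `(1 − 2c)·t² < Re (z²)` (so `Re z² > 0`: the temperature half-plane `Re (1∕z²) > 0`). [cite: Balaban1987RG1, (2.10) p.267] -/
theorem re_sq_gt_of_near {c t : ℝ} {z : ℂ} (ht : 0 < t) (hc : c < 1 / 2) (hz : dist z (t : ℂ) < c * t) :
    (1 - 2 * c) * t ^ 2 < (z ^ 2).re := by
  have hre := re_gt_of_near hz
  have him := abs_im_lt_of_near hz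
  have h1 : 0 < (1 - c) * t := by nlinarith
  have hre2 : ((1 - c) * t) ^ 2 < z.re ^ 2 := by nlinarith
  have him2 : z.im ^ 2 < (c * t) ^ 2 := by
    have := sq_lt_sq' (by linarith [(abs_lt.mp him).1]) (abs_lt.mp him).2
    simpa using this
  have h2 : (z ^ 2).re = z.re * z.re - z.im * z.im := by simp [sq]
  rw [h2]
  nlinarith

/-- `dist z t < c·t`: `‖z‖ < (1 + c)·t` (`0 < t`). [folklore] -/
theorem norm_lt_of_near {c t : ℝ} {z : ℂ} (ht : 0 < t) (hz : dist z (t : ℂ) < c * t) : ‖z‖ < (1 + c) * t := by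
  have h : ‖z‖ ≤ ‖z - (t : ℂ)‖ + ‖(t : ℂ)‖ := by
    have := norm_add_le (z - (t : ℂ)) (t : ℂ)
    rwa [sub_add_cancel] at this
  rw [dist_eq_norm] at hz
  rw [norm_real, Real.norm_of_nonneg ht.le] at h
  linarith

/-- `dist z t < c·t`: `(1 − c)·t < ‖z‖`. [folklore] -/
theorem lt_norm_of_near {c t : ℝ} {z : ℂ} (hz : dist z (t : ℂ) < c * t) : (1 - c) * t < ‖z‖ :=
  lt_of_lt_of_le (re_gt_of_near hz) (re_le_norm z)

/-- THE TEMPERATURE LOWER BOUND: `dist z t < c·t`, `0 < t`, `0 ≤ c < ½`, `0 < a` ⇒ `a·(1−2c) ∕ ((1+c)⁴·t²) ≤ a · Re ((z²)⁻¹)` (`Re (z²)⁻¹ = Re z² ∕ ‖z‖⁴`).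
[cite: Balaban1987RG1, (2.10) p.267] -/
theorem inv_sq_re_ge_of_near {c t a : ℝ} {z : ℂ} (ht : 0 < t) (hc0 : 0 ≤ c) (hc : c < 1 / 2) (ha : 0 < a) (hz : dist z (t : ℂ) < c * t) :
    a * (1 - 2 * c) / ((1 + c) ^ 4 * t ^ 2) ≤ a * ((z ^ 2)⁻¹).re := by
  have hre2 := re_sq_gt_of_near ht hc hz
  have hn := norm_lt_of_near ht hz
  have hz0 : z ≠ 0 := by
    intro h0; rw [h0] at hre2; simp at hre2; nlinarith
  have hnpos : 0 < ‖z‖ := norm_pos_iff.mpr hz0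
  have hnsq : normSq (z ^ 2) = ‖z‖ ^ 4 := by
    rw [normSq_eq_norm_sq, norm_pow]; ring
  rw [inv_re, hnsq]
  have h4 : ‖z‖ ^ 4 < ((1 + c) * t) ^ 4 := by
    have := pow_lt_pow_left₀ hn hnpos.le (by norm_num : (4 : ℕ) ≠ 0)
    simpa using this
  have h4pos : 0 < ‖z‖ ^ 4 := by positivity
  have hct : 0 < (1 + c) ^ 4 * t ^ 2 := by positivity
  have h12c : 0 < 1 - 2 * c := by linarith
  have key : (1 - 2 * c) / ((1 + c) ^ 4 * t ^ 2) ≤ (z ^ 2).re / ‖z‖ ^ 4 := by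
    rw [div_le_div_iff₀ hct h4pos]
    have hA : (1 - 2 * c) * ‖z‖ ^ 4 ≤ (1 - 2 * c) * ((1 + c) * t) ^ 4 := mul_le_mul_of_nonneg_left h4.le h12c.le
    have hB : (1 - 2 * c) * ((1 + c) * t) ^ 4 = ((1 - 2 * c) * t ^ 2) * ((1 + c) ^ 4 * t ^ 2) := by ring
    have hC : ((1 - 2 * c) * t ^ 2) * ((1 + c) ^ 4 * t ^ 2) ≤ (z ^ 2).re * ((1 + c) ^ 4 * t ^ 2) := mul_le_mul_of_nonneg_right hre2.le hct.le
    linarith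
  rw [mul_div_assoc]
  exact mul_le_mul_of_nonneg_left key ha.le

/-! ## §2 The threshold price `exp(−x) ≤ 1∕x` at the temperature (the elementary inequality is the tree's `Tao2016.exp_neg_le_inv`; inlined) -/

/-- THE THRESHOLD ON THE RELATIVE DISC: `‖exp(−a·(z²)⁻¹)‖ ≤ (1+c)⁴·t² ∕ (a·(1−2c))` for `dist z t < c·t`, `0 < t`, `0 ≤ c < ½`, `0 < a`. [cite: Balaban1987RG1, (2.9)-(2.10) pp.266-267] -/
theorem norm_exp_neg_inv_sq_le {c t a : ℝ} {z : ℂ} (ht : 0 < t) (hc0 : 0 ≤ c) (hc : c < 1 / 2) (ha : 0 < a) (hz : dist z (t : ℂ) < c * t) :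
    ‖exp (-(a : ℂ) * (z ^ 2)⁻¹)‖ ≤ (1 + c) ^ 4 * t ^ 2 / (a * (1 - 2 * c)) := by
  have hlow := inv_sq_re_ge_of_near ht hc0 hc ha hz
  have hq : 0 < a * (1 - 2 * c) / ((1 + c) ^ 4 * t ^ 2) := by
    have : 0 < 1 - 2 * c := by linarith
    positivity
  rw [norm_exp]
  have hre : (-(a : ℂ) * (z ^ 2)⁻¹).re = -(a * ((z ^ 2)⁻¹).re) := by
    simp [neg_mul, mul_re, ofReal_re, ofReal_im]
  rw [hre]
  calc Real.exp (-(a * ((z ^ 2)⁻¹).re)) ≤ Real.exp (-(a * (1 - 2 * c) / ((1 + c) ^ 4 * t ^ 2))) :=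
        Real.exp_le_exp.mpr (by linarith)
    _ ≤ 1 / (a * (1 - 2 * c) / ((1 + c) ^ 4 * t ^ 2)) := by
        -- `exp(−x) ≤ 1∕x` (the tree's `Tao2016.exp_neg_le_inv`, inlined to keep the imports local)
        rw [Real.exp_neg, one_div]
        exact inv_anti₀ hq (by linarith [Real.add_one_le_exp (a * (1 - 2 * c) / ((1 + c) ^ 4 * t ^ 2))])
    _ = (1 + c) ^ 4 * t ^ 2 / (a * (1 - 2 * c)) := by
        have : 0 < 1 - 2 * c := by linarith
        field_simp

/-! ## §3 The model possibility-1 term on the sector: holomorphic, and (S-vertex-T′)-shaped -/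

/-- **THE MODEL POSSIBILITY-1 TERM OBEYS THE CENTRED ORDER-TWO LETTER ON THE SECTOR OF APERTURE `c < ½`**: for every `z ∈ {z | ∃ t ∈ ]0,γ], dist z t < c·t}`,
`‖(V + A·z² + B·exp(−a·(z²)⁻¹)) − V‖ ≤ (‖A‖ + ‖B‖·(1+c)⁴ ∕ (a·(1−2c)·(1−c)²)) · ‖z‖²` — the (S-vertex-T′) shape of R2 ∕ R2b ∕ R2c with an explicit `Mv`, uniformly in `γ`.
[cite: Balaban1987RG1, (2.9)-(2.10) pp.266-267 and (2.13) p.268] -/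
theorem modelTerm_sub_centre_le_on_relSector {γ c a : ℝ} (hc0 : 0 ≤ c) (hc : c < 1 / 2) (ha : 0 < a) (V A B : ℂ) {z : ℂ}
    (hz : z ∈ {z : ℂ | ∃ t ∈ Ioc (0 : ℝ) γ, dist z (t : ℂ) < c * t}) :
    ‖(V + A * z ^ 2 + B * exp (-(a : ℂ) * (z ^ 2)⁻¹)) - V‖ ≤ (‖A‖ + ‖B‖ * ((1 + c) ^ 4 / (a * (1 - 2 * c) * (1 - c) ^ 2))) * ‖z‖ ^ 2 := by
  obtain ⟨t, ht, hd⟩ := hz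
  have hthr := norm_exp_neg_inv_sq_le ht.1 hc0 hc ha hd
  have hlow := lt_norm_of_near hd
  have h1c : 0 < 1 - c := by linarith
  have h12c : 0 < 1 - 2 * c := by linarith
  have ht2 : t ^ 2 ≤ ‖z‖ ^ 2 / (1 - c) ^ 2 := by
    rw [le_div_iff₀ (pow_pos h1c 2)]
    have h0 : 0 ≤ (1 - c) * t := (mul_pos h1c ht.1).le
    nlinarith [mul_self_le_mul_self h0 hlow.le]
  have hB : ‖B * exp (-(a : ℂ) * (z ^ 2)⁻¹)‖ ≤ ‖B‖ * ((1 + c) ^ 4 / (a * (1 - 2 * c) * (1 - c) ^ 2)) * ‖z‖ ^ 2 := by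
    rw [norm_mul]
    calc ‖B‖ * ‖exp (-(a : ℂ) * (z ^ 2)⁻¹)‖ ≤ ‖B‖ * ((1 + c) ^ 4 * t ^ 2 / (a * (1 - 2 * c))) := by gcongr
      _ ≤ ‖B‖ * ((1 + c) ^ 4 * (‖z‖ ^ 2 / (1 - c) ^ 2) / (a * (1 - 2 * c))) := by gcongr
      _ = ‖B‖ * ((1 + c) ^ 4 / (a * (1 - 2 * c) * (1 - c) ^ 2)) * ‖z‖ ^ 2 := by field_simp
  have hA : ‖A * z ^ 2‖ = ‖A‖ * ‖z‖ ^ 2 := by rw [norm_mul, norm_pow]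
  calc ‖(V + A * z ^ 2 + B * exp (-(a : ℂ) * (z ^ 2)⁻¹)) - V‖ = ‖A * z ^ 2 + B * exp (-(a : ℂ) * (z ^ 2)⁻¹)‖ := by ring_nf
    _ ≤ ‖A * z ^ 2‖ + ‖B * exp (-(a : ℂ) * (z ^ 2)⁻¹)‖ := norm_add_le _ _
    _ ≤ ‖A‖ * ‖z‖ ^ 2 + ‖B‖ * ((1 + c) ^ 4 / (a * (1 - 2 * c) * (1 - c) ^ 2)) * ‖z‖ ^ 2 := by rw [hA]; gcongr
    _ = (‖A‖ + ‖B‖ * ((1 + c) ^ 4 / (a * (1 - 2 * c) * (1 - c) ^ 2))) * ‖z‖ ^ 2 := by ring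

/-- **THE MODEL POSSIBILITY-1 TERM IS HOLOMORPHIC ON THE SECTOR** (any aperture `c ≤ 1`: the sector avoids zero coupling, R3 `zero_not_mem_relSector`) — the own-coupling holomorphy
half of (S-last-T′) for the model, with NO analyticity at `0`. [cite: Balaban1987RG1, (2.9)-(2.10) pp.266-267] -/
theorem differentiableOn_modelTerm_relSector {γ c : ℝ} (hc1 : c ≤ 1) (a : ℝ) (V A B : ℂ) :
    DifferentiableOn ℂ (fun z : ℂ => V + A * z ^ 2 + B * exp (-(a : ℂ) * (z ^ 2)⁻¹)) {z : ℂ | ∃ t ∈ Ioc (0 : ℝ) γ, dist z (t : ℂ) < c * t} := by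
  intro z hz
  have hz0 : z ≠ 0 := fun h => zero_not_mem_relSector (γ := γ) hc1 (h ▸ hz)
  have hz2 : z ^ 2 ≠ 0 := pow_ne_zero 2 hz0
  apply DifferentiableAt.differentiableWithinAt
  have hpow : DifferentiableAt ℂ (fun w : ℂ => w ^ 2) z := differentiableAt_pow 2
  have hinv : DifferentiableAt ℂ (fun w : ℂ => (w ^ 2)⁻¹) z := hpow.inv hz2
  have hexp : DifferentiableAt ℂ (fun w : ℂ => exp (-(a : ℂ) * (w ^ 2)⁻¹)) z := ((differentiableAt_const _).mul hinv).cexp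
  exact ((differentiableAt_const V).add ((differentiableAt_const A).mul hpow)).add ((differentiableAt_const B).mul hexp)

end YMDAG.N22.W1

end
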